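import Summits.CriticalPhenomena.CardyFormulaZ2.Theses.CardyQContinuation
import Literature.Barriers.CriticalPhenomena.EmbeddingModulusUniquenessProofs
import Summits.CriticalPhenomena.CardyFormulaZ2.Theorems.CardyQContinuationIsingJetsConformalStubHigherJetLimitsConformal
import Summits.CriticalPhenomena.CardyFormulaZ2.Theorems.CardyQContinuationIsingJetsConformalStubMirrorCrossingRatio

/-!
# `IsingJetsConformal` — route-level decomposition (crux-strategist, D-0019 glued split)

Supports crux `stmt-CriticalPhenomena-5560`
(`Summit.CriticalPhenomena.CardyFormulaZ2.Theses.CardyQContinuation.IsingJetsConformal`, route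
`CardyQContinuation`).  This file proves, sorry-free, the glue of the typed split of the crux into
three sub-cruxes, each strictly weaker than the crux and none a rewording of it:

* `JetsZero` (n = 0): the critical FK-Ising crossing ratio `P_δ(√2)` of the route's discretisation
  converges to a function of the cross-ratio — Chelkak–Smirnov 2012, Thm 6.1 (arXiv:0910.2045)
  transplanted to `meshDomain`/`discreteArc` with jointly wired arcs (in print modulo the
  discretisation; the live line `Lines/birth.lean` derives it from the named fact
  `Literature.Probability.LatticeModels.ChelkakSmirnov2012_fkIsingQuadrilateralCrossing` and the
  FKG sandwich DESIGN±);
* `HigherJetsExist` (n ≥ 1, NEW): for every `n ≥ 1` and every conformal rectangle the `n`-th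
  `s`-derivative of `P_δ` at `√2` (a mixed cumulant of the crossing indicator with `n` copies of
  the loop number `L = |ω| + 2 k_B`, Grimmett 2006 (3.75)) converges as `δ → 0⁺`;
* `HigherJetsCovariant` (n ≥ 1, NEW): those limits are covariant under conformal equivalences of
  marked rectangles (boundary values matching the four marked points).

`IsingJetsConformal_of_subs : JetsZero → HigherJetsExist → HigherJetsCovariant → IsingJetsConformal`.
The passage "covariance under marked equivalence ⇒ equal cross-ratio gives equal limits" uses the two
LANDED theorems `stub_higherJetLimitsConformal_markedEquivalence` (p144394: equal orientation and
cross-ratio ⇒ marked conformal equivalence) and `stub_mirrorCrossingRatio` (p145626: the crossing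
ratio of the complex-conjugate rectangle equals that of `R`), exactly as in the registered skeleton
`Cruxes/IsingJetsConformal/Lines/birth.lean` (`higherJetLimitsConformal_of`, `IsingJetsConformal_of`),
whose composition this file re-proves with the three sub-crux statements as hypotheses spelled out
verbatim (they become route items by `ledger route edit --split IsingJetsConformal --glue-by`).
The converse (crux ⇒ each sub-crux) is elementary (strategist folder `bc/`), so the split is an
equivalence cut: `JetsZero` isolates the published half, `HigherJetsExist ∧ HigherJetsCovariant` the
research half (`n = 1` of `HigherJetsExist` for a single rectangle is the route item `FirstJetConverges`).
-/

namespace Summit.CriticalPhenomena.CardyFormulaZ2.Theorems.CardyQContinuation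

open scoped BigOperators Topology Classical
open Filter Set
open Summit.CriticalPhenomena.CardyFormulaZ2.Theses.CardyQContinuation (IsingJetsConformal)

/-- Marked-equivalence covariance + the landed geometry (p144394, p145626) ⇒ for `n ≥ 1`, rectangles with
uniformizing data of equal cross-ratio have equal `n`-th jet limits (either orientation: the conjugate
rectangle carries the datum of opposite orientation, same cross-ratio and the same crossing ratio). -/
theorem higherJetLimits_eq_of_crossRatio_eq
    (hCov : (let w : Literature.Probability.RandomPlanarGeometry.ConformalRectangle → ℝ → ℂ → Set (Sym2 (Literature.Probability.LatticeModels.Site 2)) → ℂ := fun R δ s ω ↦ s ^ (ω.ncard + 2 * Nat.card ((Literature.Probability.Percolation.openGraph ω ⊔ Literature.Probability.LatticeModels.wired (Literature.Probability.LatticeModels.discreteArc R.carrier δ (R.arc 0) ∪ Literature.Probability.LatticeModels.discreteArc R.carrier δ (R.arc 2))).induce (Literature.Probability.LatticeModels.meshDomain R.carrier δ)).ConnectedComponent); let P : Literature.Probability.RandomPlanarGeometry.ConformalRectangle → ℝ → ℂ → ℂ := fun R δ s ↦ (∑ᶠ ω ∈ 𝒫 (Literature.Probability.LatticeModels.discreteDomainGraph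 R.carrier δ).edgeSet, (Literature.Probability.Percolation.discreteCrossing R.carrier δ (R.arc 0) (R.arc 2)).indicator (w R δ s) ω) / (∑ᶠ ω ∈ 𝒫 (Literature.Probability.LatticeModels.discreteDomainGraph R.carrier δ).edgeSet, w R δ s ω); ∀ n : ℕ, 1 ≤ n → ∀ (R R' : Literature.Probability.RandomPlanarGeometry.ConformalRectangle) (Ψ : Literature.Probability.RandomPlanarGeometry.ConformalEquiv R.carrier R'.carrier), (∀ i : Fin 4, Ψ.HasBoundaryValue (R.pt i) (R'.pt i)) → ∀ (L L' : ℂ), Filter.Tendsto (fun δ ↦ iteratedDeriv n (P R δ) (Real.sqrt 2 : ℂ)) (nhdsWithin 0 (Set.Ioi 0)) (nhds L) → Filter.Tendsto (fun δ ↦ iteratedDeriv n (P R' δ) (Real.sqrt 2 : ℂ)) (nhdsWithin 0 (Set.Ioi 0)) (nhds L') → L = L')) :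
    (let w : Literature.Probability.RandomPlanarGeometry.ConformalRectangle → ℝ → ℂ → Set (Sym2 (Literature.Probability.LatticeModels.Site 2)) → ℂ := fun R δ s ω ↦ s ^ (ω.ncard + 2 * Nat.card ((Literature.Probability.Percolation.openGraph ω ⊔ Literature.Probability.LatticeModels.wired (Literature.Probability.LatticeModels.discreteArc R.carrier δ (R.arc 0) ∪ Literature.Probability.LatticeModels.discreteArc R.carrier δ (R.arc 2))).induce (Literature.Probability.LatticeModels.meshDomain R.carrier δ)).ConnectedComponent); let P : Literature.Probability.RandomPlanarGeometry.ConformalRectangle → ℝ → ℂ → ℂ := fun R δ s ↦ (∑ᶠ ω ∈ 𝒫 (Literature.Probability.LatticeModels.discreteDomainGraph R.carrier δ).edgeSet, (Literature.Probability.Percolation.discreteCrossing R.carrier δ (R.arc 0) (R.arc 2)).indicator (w R δ s) ω) / (∑ᶠ ω ∈ 𝒫 (Literature.Probability.LatticeModels.discreteDomainGraph R.carrier δ).edgeSet, w R δ s ω); ∀ n : ℕ, 1 ≤ n → ∀ (R R' : Literature.Probability.RandomPlanarGeometry.ConformalRectangle) (φ : Literature.Probability.RandomPlanarGeometry.ConformalEquiv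 UpperHalfPlane.upperHalfPlaneSet R.carrier) (x : Fin 4 → ℝ) (φ' : Literature.Probability.RandomPlanarGeometry.ConformalEquiv UpperHalfPlane.upperHalfPlaneSet R'.carrier) (x' : Fin 4 → ℝ) (L L' : ℂ), R.IsUniformizing φ x → R'.IsUniformizing φ' x' → Literature.Probability.RandomPlanarGeometry.crossRatio x = Literature.Probability.RandomPlanarGeometry.crossRatio x' → Filter.Tendsto (fun δ ↦ iteratedDeriv n (P R δ) (Real.sqrt 2 : ℂ)) (nhdsWithin 0 (Set.Ioi 0)) (nhds L) → Filter.Tendsto (fun δ ↦ iteratedDeriv n (P R' δ) (Real.sqrt 2 : ℂ)) (nhdsWithin 0 (Set.Ioi 0)) (nhds L') → L = L') := by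
  have hM := stub_higherJetLimitsConformal_markedEquivalence
  have hX := stub_mirrorCrossingRatio
  intro w P n hn R R' φ x φ' x' L L' hU hU' hcr hL hL'
  by_cases hor : (StrictMono x ↔ StrictMono x')
  · obtain ⟨Ψ, hΨ⟩ := hM R R' φ x φ' x' hU hU' hor hcr
    exact hCov n hn R R' Ψ hΨ L L' hL hL'
  · obtain ⟨ψ, -, hUc⟩ := hU.exists_conjugate
    have hexcl : ¬ (StrictMono x ∧ StrictAnti x) := fun h ↦ by
      have h1 := h.1 (show (0 : Fin 4) < 1 by decide)
      have h2 := h.2 (show (0 : Fin 4) < 1 by decide)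
      exact lt_asymm h1 h2
    have hneg : StrictMono (-x) ↔ StrictAnti x :=
      ⟨fun h ↦ by simpa using h.neg, fun h ↦ h.neg⟩
    have hx := hU.1
    have hor' : (StrictMono (-x) ↔ StrictMono x') := by tauto
    have hcr' : Literature.Probability.RandomPlanarGeometry.crossRatio (-x) = Literature.Probability.RandomPlanarGeometry.crossRatio x' := by
      rw [Literature.Probability.RandomPlanarGeometry.crossRatio_neg]; exact hcr
    obtain ⟨Ψ, hΨ⟩ := hM R.conjugate R' ψ (-x) φ' x' hUc hU' hor' hcr'
    refine hCov n hn R.conjugate R' Ψ hΨ L L' ?_ hL'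
    refine hL.congr' ?_
    filter_upwards [self_mem_nhdsWithin] with δ hδ
    exact congrArg (fun f : ℂ → ℂ ↦ iteratedDeriv n f (Real.sqrt 2 : ℂ))
      (funext fun s ↦ (hX R δ hδ s).symm)

/-- **The glue of the split** `IsingJetsConformal ⇐ JetsZero ∧ HigherJetsExist ∧ HigherJetsCovariant`
(hypotheses = the three sub-crux statements verbatim; conclusion = the crux BY NAME).
`n = 0`: `JetsZero` after `iteratedDeriv_zero`.  `n = k + 1`: `c η :=` the `HigherJetsExist` limit of SOME
rectangle with a uniformizing datum of cross-ratio `η` (chosen; `0` if there is none); for the given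
`(R, φ, x)` existence gives a limit `L`, and `higherJetLimits_eq_of_crossRatio_eq` identifies `L` with the
chosen representative's. -/
theorem IsingJetsConformal_of_subs
    (h0 : (let w : Literature.Probability.RandomPlanarGeometry.ConformalRectangle → ℝ → ℂ → Set (Sym2 (Literature.Probability.LatticeModels.Site 2)) → ℂ := fun R δ s ω ↦ s ^ (ω.ncard + 2 * Nat.card ((Literature.Probability.Percolation.openGraph ω ⊔ Literature.Probability.LatticeModels.wired (Literature.Probability.LatticeModels.discreteArc R.carrier δ (R.arc 0) ∪ Literature.Probability.LatticeModels.discreteArc R.carrier δ (R.arc 2))).induce (Literature.Probability.LatticeModels.meshDomain R.carrier δ)).ConnectedComponent); let P : Literature.Probability.RandomPlanarGeometry.ConformalRectangle → ℝ → ℂ → ℂ := fun R δ s ↦ (∑ᶠ ω ∈ 𝒫 (Literature.Probability.LatticeModels.discreteDomainGraph R.carrier δ).edgeSet, (Literature.Probability.Percolation.discreteCrossing R.carrier δ (R.arc 0) (R.arc 2)).indicator (w R δ s) ω) / (∑ᶠ ω ∈ 𝒫 (Literature.Probability.LatticeModels.discreteDomainGraph R.carrier δ).edgeSet, w R δ s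 ω); ∃ c : ℝ → ℂ, ∀ (R : Literature.Probability.RandomPlanarGeometry.ConformalRectangle) (φ : Literature.Probability.RandomPlanarGeometry.ConformalEquiv UpperHalfPlane.upperHalfPlaneSet R.carrier) (x : Fin 4 → ℝ), R.IsUniformizing φ x → Filter.Tendsto (fun δ ↦ P R δ (Real.sqrt 2 : ℂ)) (nhdsWithin 0 (Set.Ioi 0)) (nhds (c (Literature.Probability.RandomPlanarGeometry.crossRatio x)))))
    (hE : (let w : Literature.Probability.RandomPlanarGeometry.ConformalRectangle → ℝ → ℂ → Set (Sym2 (Literature.Probability.LatticeModels.Site 2)) → ℂ := fun R δ s ω ↦ s ^ (ω.ncard + 2 * Nat.card ((Literature.Probability.Percolation.openGraph ω ⊔ Literature.Probability.LatticeModels.wired (Literature.Probability.LatticeModels.discreteArc R.carrier δ (R.arc 0) ∪ Literature.Probability.LatticeModels.discreteArc R.carrier δ (R.arc 2))).induce (Literature.Probability.LatticeModels.meshDomain R.carrier δ)).ConnectedComponent); let P : Literature.Probability.RandomPlanarGeometry.ConformalRectangle → ℝ → ℂ → ℂ := fun R δ s ↦ (∑ᶠ ω ∈ 𝒫 (Literature.Probability.LatticeModels.discreteDomainGraph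 R.carrier δ).edgeSet, (Literature.Probability.Percolation.discreteCrossing R.carrier δ (R.arc 0) (R.arc 2)).indicator (w R δ s) ω) / (∑ᶠ ω ∈ 𝒫 (Literature.Probability.LatticeModels.discreteDomainGraph R.carrier δ).edgeSet, w R δ s ω); ∀ n : ℕ, 1 ≤ n → ∀ R : Literature.Probability.RandomPlanarGeometry.ConformalRectangle, ∃ L : ℂ, Filter.Tendsto (fun δ ↦ iteratedDeriv n (P R δ) (Real.sqrt 2 : ℂ)) (nhdsWithin 0 (Set.Ioi 0)) (nhds L)))
    (hCov : (let w : Literature.Probability.RandomPlanarGeometry.ConformalRectangle → ℝ → ℂ → Set (Sym2 (Literature.Probability.LatticeModels.Site 2)) → ℂ := fun R δ s ω ↦ s ^ (ω.ncard + 2 * Nat.card ((Literature.Probability.Percolation.openGraph ω ⊔ Literature.Probability.LatticeModels.wired (Literature.Probability.LatticeModels.discreteArc R.carrier δ (R.arc 0) ∪ Literature.Probability.LatticeModels.discreteArc R.carrier δ (R.arc 2))).induce (Literature.Probability.LatticeModels.meshDomain R.carrier δ)).ConnectedComponent); let P : Literature.Probability.RandomPlanarGeometry.ConformalRectangle → ℝ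 → ℂ → ℂ := fun R δ s ↦ (∑ᶠ ω ∈ 𝒫 (Literature.Probability.LatticeModels.discreteDomainGraph R.carrier δ).edgeSet, (Literature.Probability.Percolation.discreteCrossing R.carrier δ (R.arc 0) (R.arc 2)).indicator (w R δ s) ω) / (∑ᶠ ω ∈ 𝒫 (Literature.Probability.LatticeModels.discreteDomainGraph R.carrier δ).edgeSet, w R δ s ω); ∀ n : ℕ, 1 ≤ n → ∀ (R R' : Literature.Probability.RandomPlanarGeometry.ConformalRectangle) (Ψ : Literature.Probability.RandomPlanarGeometry.ConformalEquiv R.carrier R'.carrier), (∀ i : Fin 4, Ψ.HasBoundaryValue (R.pt i) (R'.pt i)) → ∀ (L L' : ℂ), Filter.Tendsto (fun δ ↦ iteratedDeriv n (P R δ) (Real.sqrt 2 : ℂ)) (nhdsWithin 0 (Set.Ioi 0)) (nhds L) → Filter.Tendsto (fun δ ↦ iteratedDeriv n (P R' δ) (Real.sqrt 2 : ℂ)) (nhdsWithin 0 (Set.Ioi 0)) (nhds L') → L = L')) :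
    IsingJetsConformal := by
  have hC := higherJetLimits_eq_of_crossRatio_eq hCov
  intro n
  cases n with
  | zero =>
    obtain ⟨c, hc⟩ := h0
    refine ⟨c, fun R φ x hU => ?_⟩
    simp only [iteratedDeriv_zero]
    exact hc R φ x hU
  | succ k =>
    have hn : 1 ≤ k + 1 := Nat.succ_le_succ (Nat.zero_le k)
    refine ⟨fun η ↦ if h : ∃ (R' : Literature.Probability.RandomPlanarGeometry.ConformalRectangle) (φ' : Literature.Probability.RandomPlanarGeometry.ConformalEquiv UpperHalfPlane.upperHalfPlaneSet R'.carrier) (x' : Fin 4 → ℝ),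
        R'.IsUniformizing φ' x' ∧ Literature.Probability.RandomPlanarGeometry.crossRatio x' = η then Classical.choose (hE (k + 1) hn h.choose) else 0,
      fun R φ x hU => ?_⟩
    obtain ⟨L, hL⟩ := hE (k + 1) hn R
    have hex : ∃ (R' : Literature.Probability.RandomPlanarGeometry.ConformalRectangle) (φ' : Literature.Probability.RandomPlanarGeometry.ConformalEquiv UpperHalfPlane.upperHalfPlaneSet R'.carrier) (x' : Fin 4 → ℝ),
        R'.IsUniformizing φ' x' ∧ Literature.Probability.RandomPlanarGeometry.crossRatio x' = Literature.Probability.RandomPlanarGeometry.crossRatio x := ⟨R, φ, x, hU, rfl⟩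
    obtain ⟨φ', x', hU', hη'⟩ := hex.choose_spec
    have hLL : L = Classical.choose (hE (k + 1) hn hex.choose) :=
      hC (k + 1) hn R hex.choose φ x φ' x' L _ hU hU' hη'.symm hL
        (Classical.choose_spec (hE (k + 1) hn hex.choose))
    beta_reduce
    rw [dif_pos hex, ← hLL]
    exact hL

end Summit.CriticalPhenomena.CardyFormulaZ2.Theorems.CardyQContinuation
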